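import Summits.BirchSwinnertonDyer.Rank1Residual.X12.O11.RamifiedEllipticUnitMechanismZp
import Summits.BirchSwinnertonDyer.Rank1Residual.X12.CMSevenAwayFromSeven
import HarnessLib

set_option linter.dupNamespace false

/-!
# Route `RamifiedSevenEllipticUnits` (rung K7r): Theorems-side BRIDGE to the O11 elliptic-unit mechanism
# over the CORRECTED carrier `𝒪_𝔭 · z(𝟙)` (planner D117 (R3); the `…Zp` twin of
# `RamifiedSevenEllipticUnitsMechanismBridge.lean`) — imported BY the route file after the edit E-Zp

Cell `bsd-cm`, seat `bsd-cm-k7r-c4` (g5). HONEST FRAMING: nothing here closes an item; BSD is not proved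
by any of this. Route files import only `Summits.BirchSwinnertonDyer.BirchSwinnertonDyer.Theorems.*` (D66)
and are imported by every other K7r Theorems file, so THIS file imports NO `Theses` module (no cycle) and
states everything over the BODIES of the repaired items, `CMRungInputs`-style: the E-Zp items
`EllipticUnitIMCSevenZp` (support/residual, cite-level: ∀ W ∈ 𝒞₇, `O11.RamifiedCMEllipticUnitIMCAtZp W 7`,
the ∃-form (R-IMC)∃-Zp over the `p`-adic span, φ pinned to `W`, `Ω ≠ 0`) and `EllipticUnitValueSevenOfGZK`
(crux, attacked: GZK → ∀ W ∈ 𝒞₇, `O11.RamifiedCMBottomClassIndexLawAtZp W 7`) reach the O11 module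
`X12/O11/RamifiedEllipticUnitMechanismZp.lean` through this file, and the planner's E-Zp `closes` consumes
`ellipticUnitIndexAt_seven_of_imcZp_of_valueZp h₁ (h₂ hGZK)` directly (turnkey
`pub/bsd-cm/bsd-cm-plan/g19/ezp/glue_zp.lean`).

WHY a Zp twin (D117): the original pair 19704/19705 is typed over `D.HasBottomIndexExp c`, whose carrier
`endSpan` is the ℤ-span of the `End_K(E)`-translates; that exponent is unsatisfiable at every positive-rank
frame (cell memo MEMO-k7r-c4-g5-CARRIER, evidence #10 on 19705; k7r-c2 SB4-RECUT; k8i-c2's kernel witness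
`Theorems/RamifiedSevenEllipticUnitsBottomIndexVacuity.lean`), so 19704 is real-world false and 19705 vacuous.
Over `HasBottomIndexExpZp` (Literature `…/PadicEndSpan.lean`) the same seams re-prove verbatim.

* `ellipticUnitIndexAt_seven_of_imcZp_of_valueZp` — IMC-Zp piece → VALUE-Zp piece → (R-EU)@7 on 𝒞₇ (bodies);
* `valueZp_seven_of_ellipticUnitIndexAt` — converse modulo (R-tors)@7 on 𝒞₇ only (BC2 «no weakening»).

References: [BurungaleKobayashiNakamuraOta2026] §3, Thm. 3.14 (3), Thm. 7.2, §1.4 (arXiv:2608.06879; shape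
only); [Rubin1991MainConj] Thm. 4.1; [Miller2011LMS] Def. 1.1; cell STATUS D117 (2026-08-26T18:42Z).
-/

noncomputable section

open scoped Classical

open WeierstrassCurve NumberField IsDedekindDomain
  Literature.NumberTheory.EllipticCurves
  Literature.NumberTheory.EllipticCurves.Rank1Residual

namespace Summit.BirchSwinnertonDyer.BirchSwinnertonDyer.Rank1Residual.EllipticUnitMechanismBridgeZp

open Summit.BirchSwinnertonDyer.Rank1Residual Summit.BirchSwinnertonDyer.Rank1Residual.X12.O11

/-- **IMC-Zp piece → VALUE-Zp piece → (R-EU)@7 on 𝒞₇** — the E-Zp glue over the item BODIES (the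
conclusion is literally the body of the route item `EllipticUnitIndexSeven`, so the planner's `closes` applies
`ellipticUnitIndexAt_seven_of_imcZp_of_valueZp h₁ (h₂ hGZK)`): for every global minimal `W ∈ 𝒞₇`, (R-IMC)∃-Zp@7
and the relative law (R-PR)|IMC-Zp@7 give (R-EU)@7 by the O11 seam
`ramifiedCMEllipticUnitIndexAt_of_imcZp_of_indexLawZp` (D117: the children are
`∀ W ∈ 𝒞₇, O11.RamifiedCMEllipticUnitIMCAtZp W 7` (support) and `∀ W ∈ 𝒞₇, O11.RamifiedCMBottomClassIndexLawAtZp W 7`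
(crux, under GZK); existence is implied by the former).
[cite: Miller2011LMS, Def. 1.1] [cite: BurungaleKobayashiNakamuraOta2026, Thm. 3.14 (3) and §1.4 (arXiv:2608.06879; shape only)] -/
theorem ellipticUnitIndexAt_seven_of_imcZp_of_valueZp
    (h₁ : ∀ (W : WeierstrassCurve ℚ) [W.IsElliptic] [W.IsGloballyMinimal] [Fact (Nat.Prime 7)],
      X12.ClassCSeven W → RamifiedCMEllipticUnitIMCAtZp W 7)
    (h₂ : ∀ (W : WeierstrassCurve ℚ) [W.IsElliptic] [W.IsGloballyMinimal] [Fact (Nat.Prime 7)],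
      X12.ClassCSeven W → RamifiedCMBottomClassIndexLawAtZp W 7) :
    ∀ (W : WeierstrassCurve ℚ) [W.IsElliptic] [W.IsGloballyMinimal] [Fact (Nat.Prime 7)],
      X12.ClassCSeven W → RamifiedCMEllipticUnitIndexAt W 7 :=
  fun W _ _ _ hC => ramifiedCMEllipticUnitIndexAt_of_imcZp_of_indexLawZp (h₁ W hC) (h₂ W hC)

/-- **Converse (BC2 «no weakening»)**: (R-EU)@7 on 𝒞₇ gives the VALUE-Zp piece back, granted only
(R-tors)@7 on 𝒞₇ (the body of `StrictTorsionSeven`; a theorem under GZK, p430232 / p447509) — no IMC piece is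
needed in this direction; the pinning binders and the corrected carrier only weaken the ∀-statement.
[cite: Miller2011LMS, Def. 1.1] -/
theorem valueZp_seven_of_ellipticUnitIndexAt
    (h₂ : ∀ (W : WeierstrassCurve ℚ) [W.IsElliptic] [W.IsGloballyMinimal] [Fact (Nat.Prime 7)],
      X12.ClassCSeven W → RamifiedCMStrictTorsionAt W 7)
    (h : ∀ (W : WeierstrassCurve ℚ) [W.IsElliptic] [W.IsGloballyMinimal] [Fact (Nat.Prime 7)],
      X12.ClassCSeven W → RamifiedCMEllipticUnitIndexAt W 7) :
    ∀ (W : WeierstrassCurve ℚ) [W.IsElliptic] [W.IsGloballyMinimal] [Fact (Nat.Prime 7)],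
      X12.ClassCSeven W → RamifiedCMBottomClassIndexLawAtZp W 7 :=
  fun W _ _ _ hC => ramifiedCMBottomClassIndexLawAtZp_of_indexAt (h W hC) (h₂ W hC)

end Summit.BirchSwinnertonDyer.BirchSwinnertonDyer.Rank1Residual.EllipticUnitMechanismBridgeZp

end
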